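import Summits.Schanuel.Schanuel.Theorems.ZilberEacLineSurfaceLemmas
import Summits.Schanuel.Schanuel.Theorems.ZilberEacGraphSurfaceUnbalanced
import HarnessLib

/-!
# Logarithmic strips, V-b: escaping exponential points of NON-SPLIT surfaces over a line of
# non-real slope

HONEST FRAMING.  Cell `pub-schanuel` (Zilber's Exponential-Algebraic Closedness, case ladder;
host summit Schanuel), seat 2, gen 17.  For `W = {x₁ = ax₀ + b, P(x₀; y₀, y₁) = 0}` with
`Im a ≠ 0` and `P ∈ ℂ[x, y₀, y₁]` having two monomials of different `y₁`-degree, the exponential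
points solve `P(z; e^z, e^{az+b}) = 0`; after the lower-left edge decomposition (gen 16) this is
`Σ_{m ∈ M} c_m z^{m₀} e^{e_m(αz + b)} + E(z) = 0`, `α = a + s`, `Im α ≠ 0` — engine v4 along the
escaping degree-one corrected roots (`exists_lineRoot_seq_escape`), the `E`-term being exponentially
small because `Re z₀ → -∞` linearly: **`exists_lineSurface_expPoints_of_im_ne_zero`**.  This is
the polynomial-coefficient (non-split) version of gen 16's `exists_lineCurve_expPoints_of_im_ne_zero`,
with no balance hypothesis.  Density: `ZilberEacLineSurfaceDensity`.  NOT Schanuel's conjecture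
(neither used nor implied; EAC ⇏ SC); `EC(3,2)` stays OPEN; instances of an OPEN question
(PLMS 2024, §1 p. 5).
-/

noncomputable section

open Filter Topology Metric Set Complex
open Literature.ModelTheory.Zilber

set_option linter.dupNamespace false

namespace Summit.Schanuel.Schanuel.Theorems

/-- **Escaping zeros of `P(z; e^z, e^{az+b})`, non-real slope, any `P` with two `y₁`-degrees.**
`Im a ≠ 0`; `P ∈ ℂ[x, y₀, y₁]` with two monomials of different `y₁`-degree ⟹ there are `z_k`
with `P(z_k; e^{z_k}, e^{az_k+b}) = 0` and `|Re z_k|/log(2 + ‖z_k‖) → ∞`. (new) -/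
theorem exists_lineSurface_expPoints_of_im_ne_zero (a b : ℂ) (ha : a.im ≠ 0)
    (P : MvPolynomial (Fin 3) ℂ) (h2 : ∃ m ∈ P.support, ∃ m' ∈ P.support, m 2 ≠ m' 2) :
    ∃ z : ℕ → ℂ, (∀ k, MvPolynomial.eval ![z k, exp (z k), exp ((linePoly a b).eval (z k))] P = 0) ∧
      Tendsto (fun k => |(z k).re| / Real.log (2 + ‖z k‖)) atTop atTop := by
  classical
  obtain ⟨s, mb, hmb, hE1, hE2, ms, hmsA, hms2, hmsw⟩ := exists_lowerLeft_edge₃ P.support h2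
  set p : Polynomial ℂ := linePoly a b with hp
  set R₀ : Polynomial ℂ := p + Polynomial.C (s : ℂ) * Polynomial.X with hR₀
  set α : ℂ := a + s with hα_def
  have hR : ∀ z, R₀.eval z = α * z + b := by
    intro z
    rw [hR₀, hp, Polynomial.eval_add, eval_linePoly, Polynomial.eval_mul, Polynomial.eval_C,
      Polynomial.eval_X, hα_def]
    ring
  have hαim : α.im ≠ 0 := by simpa [hα_def] using ha
  have hα0 : α ≠ 0 := by rintro h; exact hαim (by rw [h]; simp)
  have hαpos : 0 < ‖α‖ := norm_pos_iff.2 hα0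
  -- the edge, its coefficient polynomials, the upper edge and the top polynomial
  set M := P.support.filter
    (fun m : Fin 3 →₀ ℕ => ((m 1 : ℝ) - s * m 2) = (mb 1 : ℝ) - s * mb 2) with hM
  set Nf := P.support.filter
    (fun m : Fin 3 →₀ ℕ => ¬ ((m 1 : ℝ) - s * m 2) = (mb 1 : ℝ) - s * mb 2) with hNf
  have hmbM : mb ∈ M := Finset.mem_filter.2 ⟨hmb, rfl⟩
  have hmsM : ms ∈ M := Finset.mem_filter.2 ⟨hmsA, hmsw⟩
  have hMle : ∀ m ∈ M, mb 2 ≤ m 2 := fun m hm =>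
    hE2 m (Finset.mem_filter.1 hm).1 (Finset.mem_filter.1 hm).2
  set q : (Fin 3 →₀ ℕ) → Polynomial ℂ := fun m =>
    Polynomial.C (P.coeff m) * Polynomial.X ^ (m 0) with hq_def
  set e : (Fin 3 →₀ ℕ) → ℕ := fun m => m 2 - mb 2 with he_def
  have hq_deg : ∀ m ∈ M, (q m).natDegree = m 0 := fun m hm =>
    Polynomial.natDegree_C_mul_X_pow _ _
      (MvPolynomial.mem_support_iff.1 (Finset.mem_filter.1 hm).1)
  have hq_lc : ∀ m, (q m).leadingCoeff = P.coeff m := fun m =>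
    Polynomial.leadingCoeff_C_mul_X_pow _ _
  obtain ⟨μ, κ, hκ, ma, hma, mc, hmc, hjne, hja, hjc⟩ := exists_upper_edge M e (fun m => m 0)
    ⟨mb, hmbM, ms, hmsM, by
      have hlt : mb 2 < ms 2 := lt_of_le_of_ne (hMle ms hmsM) (Ne.symm hms2)
      simp only [he_def]; omega⟩
  have hκ' : ∀ m ∈ M, ((q m).natDegree : ℝ) + μ * e m ≤ κ := fun m hm => by
    rw [hq_deg m hm]; exact hκ m hm
  set Jt := M.filter (fun m => ((q m).natDegree : ℝ) + μ * e m = κ) with hJt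
  set Qμ : Polynomial ℂ := ∑ m ∈ Jt, Polynomial.C (q m).leadingCoeff * Polynomial.X ^ (e m)
    with hQμ
  have hmem_top : ∀ {m}, m ∈ M → ((m 0 : ℝ) + μ * e m = κ) → m ∈ Jt := fun {m} hm h =>
    Finset.mem_filter.2 ⟨hm, by rw [hq_deg m hm]; exact h⟩
  have hmaT : ma ∈ Jt := hmem_top hma hja
  have hmcT : mc ∈ Jt := hmem_top hmc hjc
  have hinj : ∀ m ∈ Jt, ∀ m' ∈ Jt, e m = e m' → m = m' := by
    intro m hm m' hm' hee
    obtain ⟨hmM, hmt⟩ := Finset.mem_filter.1 hm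
    obtain ⟨hm'M, hm't⟩ := Finset.mem_filter.1 hm'
    have h2eq : m 2 = m' 2 := by
      have := hMle m hmM; have := hMle m' hm'M
      simp only [he_def] at hee; omega
    have h0eq : m 0 = m' 0 := by
      rw [hq_deg m hmM] at hmt; rw [hq_deg m' hm'M] at hm't
      rw [hee] at hmt
      have : (m 0 : ℝ) = m' 0 := by linarith
      exact_mod_cast this
    exact gse_eq_of_weight_eq ((Finset.mem_filter.1 hmM).2.trans (Finset.mem_filter.1 hm'M).2.symm)
      h2eq h0eq
  have hcoeff : ∀ m₁ ∈ Jt, Qμ.coeff (e m₁) = P.coeff m₁ := by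
    intro m₁ hm₁
    rw [hQμ, Polynomial.finsetSum_coeff, Finset.sum_eq_single m₁]
    · rw [Polynomial.coeff_C_mul, Polynomial.coeff_X_pow, if_pos rfl, mul_one, hq_lc]
    · intro m hm hne
      rw [Polynomial.coeff_C_mul, Polynomial.coeff_X_pow, if_neg, mul_zero]
      exact fun h => hne (hinj m hm m₁ hm₁ h.symm)
    · intro h; exact (h hm₁).elim
  have hca : Qμ.coeff (e ma) ≠ 0 := by
    rw [hcoeff ma hmaT]; exact MvPolynomial.mem_support_iff.1 (Finset.mem_filter.1 hma).1
  have hcc : Qμ.coeff (e mc) ≠ 0 := by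
    rw [hcoeff mc hmcT]; exact MvPolynomial.mem_support_iff.1 (Finset.mem_filter.1 hmc).1
  obtain ⟨θ, hθ0, hθ⟩ : ∃ θ : ℂ, θ ≠ 0 ∧ Qμ.eval θ = 0 := by
    rcases lt_or_gt_of_ne hjne with hlt | hgt
    · exact exists_root_ne_zero_of_coeff_ne_zero (e mc) Qμ (e ma) hlt hca hcc
    · exact exists_root_ne_zero_of_coeff_ne_zero (e ma) Qμ (e mc) hgt hcc hca
  have hQ : Qμ ≠ 0 := fun h => hca (by rw [h, Polynomial.coeff_zero])
  -- the weight gap and the degree bounds; the off-edge part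
  obtain ⟨δ, hδpos, hδ⟩ : ∃ δ : ℝ, 0 < δ ∧ ∀ m ∈ P.support,
      ¬ ((m 1 : ℝ) - s * m 2) = (mb 1 : ℝ) - s * mb 2 →
        δ ≤ ((m 1 : ℝ) - s * m 2) - ((mb 1 : ℝ) - s * mb 2) := by
    by_cases hNe : Nf.Nonempty
    · obtain ⟨mm, hmm, hmmmin⟩ := Nf.exists_min_image
        (fun m => ((m 1 : ℝ) - s * m 2) - ((mb 1 : ℝ) - s * mb 2)) hNe
      obtain ⟨hmmA, hmmw⟩ := Finset.mem_filter.1 hmm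
      refine ⟨((mm 1 : ℝ) - s * mm 2) - ((mb 1 : ℝ) - s * mb 2), ?_, fun m hm hmw =>
        hmmmin m (Finset.mem_filter.2 ⟨hm, hmw⟩)⟩
      have := hE1 mm hmmA
      rcases this.lt_or_eq with h | h
      · linarith
      · exact absurd h.symm hmmw
    · refine ⟨1, zero_lt_one, fun m hm hmw => ?_⟩
      exact absurd ⟨m, Finset.mem_filter.2 ⟨hm, hmw⟩⟩ hNe
  set N : ℕ := P.support.sup (fun m => m 0) with hNdef
  have hN : ∀ m ∈ P.support, m 0 ≤ N := fun m hm => Finset.le_sup (f := fun m => m 0) hm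
  set N₂ : ℕ := P.support.sup (fun m => m 2) with hN₂def
  have hN₂ : ∀ m ∈ P.support, m 2 ≤ N₂ := fun m hm => Finset.le_sup (f := fun m => m 2) hm
  set N' : ℕ := ⌈(N₂ : ℝ) * |μ|⌉₊ with hN'def
  have hN' : ∀ m ∈ P.support, |(m 2 : ℝ) - mb 2| * |μ| ≤ N' := by
    intro m hm
    have h1 : |(m 2 : ℝ) - mb 2| ≤ N₂ := by
      rw [abs_le]
      constructor
      · have : (mb 2 : ℝ) ≤ N₂ := by exact_mod_cast hN₂ mb hmb
        linarith [(Nat.cast_nonneg (m 2) : (0 : ℝ) ≤ m 2)]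
      · have : (m 2 : ℝ) ≤ N₂ := by exact_mod_cast hN₂ m hm
        linarith [(Nat.cast_nonneg (mb 2) : (0 : ℝ) ≤ mb 2)]
    exact (mul_le_mul_of_nonneg_right h1 (abs_nonneg μ)).trans (Nat.le_ceil _)
  set E : ℂ → ℂ := fun z => ∑ m ∈ Nf, P.coeff m * z ^ (m 0) *
    exp ((((m 1 : ℝ) - s * m 2 - ((mb 1 : ℝ) - s * mb 2) : ℝ) : ℂ) * z +
      (((m 2 : ℝ) - mb 2 : ℝ) : ℂ) * R₀.eval z) with hEdef
  have hEdiff : Differentiable ℂ E := differentiable_offEdgeSum₃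
  obtain ⟨C, hC0, N'', hC⟩ : ∃ C : ℝ, 0 ≤ C ∧ ∃ N'' : ℕ, ∀ z : ℂ, z.re ≤ 0 → 1 ≤ ‖z‖ →
      |(R₀.eval z).re - μ * Real.log ‖z‖| ≤ |(Complex.log θ).re| + 1 + |μ| / 8 →
        ‖E z‖ ≤ C * (1 + ‖z‖) ^ N'' * Real.exp (δ * z.re) :=
    ⟨∑ m ∈ Nf, ‖P.coeff m‖ * Real.exp (|(m 2 : ℝ) - mb 2| * (|(Complex.log θ).re| + 1 + |μ| / 8)),
      Finset.sum_nonneg fun m _ => by positivity, N + N', fun z hz hz1 hzB =>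
        norm_offEdgeSum₃_le_log hδ hN hN' hz hz1 hzB⟩
  -- the escaping corrected roots
  obtain ⟨t, z₀, Lg, κ₁, A, hκ₁, hA, htt, hroot⟩ :=
    exists_lineRoot_seq_escape α hαim b (Complex.log θ) μ (16 / ‖α‖ + 1 + 1 / ‖α‖)
  have hLz : ∀ k, exp (Lg k) = z₀ k := fun k => (hroot k).1
  have hz₀θ : ∀ k, exp (α * z₀ k + b) = θ * exp ((μ : ℂ) * Lg k) := by
    intro k; rw [(hroot k).2.1, Complex.exp_log hθ0]
  have hReL : ∀ k, (Lg k).re = Real.log ‖z₀ k‖ := fun k => re_eq_log_norm_of_exp_eq (hLz k)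
  have ht1 : ∀ k, 1 ≤ t k := fun k => (hroot k).2.2.2.1
  have hrez₀ : ∀ k, (z₀ k).re ≤ -(κ₁ * t k) := fun k => (hroot k).2.2.2.2.1
  have hnz₀ : ∀ k, ‖z₀ k‖ ≤ A * t k := fun k => (hroot k).2.2.2.2.2.1
  have hRz₀ : ∀ k, 16 / ‖α‖ + 1 + 1 / ‖α‖ ≤ ‖z₀ k‖ := fun k => (hroot k).2.2.2.2.2.2
  have hα16 : 0 ≤ 16 / ‖α‖ := by positivity
  have hα1 : 0 ≤ 1 / ‖α‖ := by positivity
  have hz₀1 : ∀ k, 1 ≤ ‖z₀ k‖ := fun k => by linarith [hRz₀ k]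
  have hz₀norm : Tendsto (fun k => ‖z₀ k‖) atTop atTop := by
    refine tendsto_atTop_mono (fun k => ?_) (htt.const_mul_atTop hκ₁)
    have h1 := hrez₀ k
    have h2 := abs_re_le_norm (z₀ k)
    have h3 : -(z₀ k).re ≤ |(z₀ k).re| := neg_le_abs _
    linarith
  -- `E` is small along the roots, in the normalised form of engine v4
  set Nκ : ℕ := ⌈|κ|⌉₊ with hNκ
  have hdecay : Tendsto (fun k => C * Real.exp (δ / ‖α‖) *
      ((A * t k + (1 + 1 / ‖α‖)) ^ (N'' + Nκ) * Real.exp (-(δ * κ₁ * t k)))) atTop (𝓝 0) := by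
    have h := ((tendsto_affinePow_mul_exp_neg A (1 + 1 / ‖α‖) (by positivity : 0 < δ * κ₁)
      (N'' + Nκ)).comp htt).const_mul (C * Real.exp (δ / ‖α‖))
    rw [mul_zero] at h
    exact h
  have hEs : ∀ η : ℝ, 0 < η → ∀ᶠ k in atTop, ∀ u ∈ closedBall (0 : ℂ) 1,
      ‖E (z₀ k + u / α)‖ ≤ η * ‖exp ((κ : ℂ) * Lg k)‖ := by
    intro η hη
    have hev1 := hdecay.eventually (gt_mem_nhds hη)
    have hev2 : ∀ᶠ k in atTop, 1 / ‖α‖ ≤ κ₁ * t k :=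
      (htt.const_mul_atTop hκ₁).eventually_ge_atTop _
    filter_upwards [hev1, hev2] with k hk1 hk2 u hu
    rw [mem_closedBall, dist_zero_right] at hu
    set z : ℂ := z₀ k + u / α with hz_def
    have hzz₀ : ‖z - z₀ k‖ ≤ 1 / ‖α‖ := by
      rw [hz_def, add_sub_cancel_left, norm_div]
      exact div_le_div_of_nonneg_right hu hαpos.le
    have hzre : z.re ≤ (z₀ k).re + 1 / ‖α‖ := by
      have h1 := re_le_norm (z - z₀ k)
      rw [Complex.sub_re] at h1
      linarith
    have hz0 : z.re ≤ 0 := by linarith [hrez₀ k]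
    have hz1 : 1 ≤ ‖z‖ := by
      have h1 := norm_sub_norm_le (z₀ k) z
      rw [norm_sub_rev] at h1
      linarith [hRz₀ k]
    have h16 : 16 * (1 / ‖α‖) ≤ ‖z₀ k‖ := by
      rw [show 16 * (1 / ‖α‖) = 16 / ‖α‖ by ring]; linarith [hRz₀ k]
    have hlr : |Real.log ‖z‖ - Real.log ‖z₀ k‖| ≤ 1 / 8 :=
      abs_log_norm_sub_log_norm_le_of_scale (by positivity) h16 hzz₀
    have hwin : |(R₀.eval z).re - μ * Real.log ‖z‖| ≤ |(Complex.log θ).re| + 1 + |μ| / 8 := by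
      have e1 : (R₀.eval z).re - μ * Real.log ‖z‖ =
          (Complex.log θ).re + u.re + μ * (Real.log ‖z₀ k‖ - Real.log ‖z‖) := by
        rw [hR, hz_def, show α * (z₀ k + u / α) + b = (α * z₀ k + b) + u by field_simp; ring,
          Complex.add_re, (hroot k).2.2.1]
        ring
      rw [e1]
      have h1 := abs_re_le_norm u
      have h3 := abs_add_le ((Complex.log θ).re + u.re) (μ * (Real.log ‖z₀ k‖ - Real.log ‖z‖))
      have h4 := abs_add_le (Complex.log θ).re u.re
      have h6 : |μ * (Real.log ‖z₀ k‖ - Real.log ‖z‖)| ≤ |μ| / 8 := by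
        rw [abs_mul, abs_sub_comm]
        calc |μ| * |Real.log ‖z‖ - Real.log ‖z₀ k‖| ≤ |μ| * (1 / 8) :=
              mul_le_mul_of_nonneg_left hlr (abs_nonneg _)
          _ = |μ| / 8 := by ring
      linarith
    have h5 := hC z hz0 hz1 hwin
    -- `‖e^{κL}‖ = e^{κ log ‖z₀‖} ≥ (1 + ‖z₀‖)^{-Nκ}`-type bound
    have hD : ‖exp ((κ : ℂ) * Lg k)‖ = Real.exp (κ * Real.log ‖z₀ k‖) := by
      rw [Complex.norm_exp, Complex.re_ofReal_mul, hReL]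
    have hDinv : Real.exp (-(κ * Real.log ‖z₀ k‖)) ≤ (A * t k + (1 + 1 / ‖α‖)) ^ Nκ := by
      calc Real.exp (-(κ * Real.log ‖z₀ k‖)) ≤ Real.exp (|κ| * Real.log ‖z₀ k‖) := by
            refine Real.exp_le_exp.2 ?_
            rw [← neg_mul]
            exact mul_le_mul_of_nonneg_right (neg_le_abs κ) (Real.log_nonneg (hz₀1 k))
        _ ≤ (A * t k + (1 + 1 / ‖α‖)) ^ Nκ :=
            exp_mul_log_le_pow (Nat.le_ceil _) (hz₀1 k) (by linarith [hnz₀ k])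
    have hzle : 1 + ‖z‖ ≤ A * t k + (1 + 1 / ‖α‖) := by
      have := norm_le_insert' z (z₀ k)
      linarith [hnz₀ k]
    have hexp_le : Real.exp (δ * z.re) ≤ Real.exp (δ / ‖α‖) * Real.exp (-(δ * κ₁ * t k)) := by
      rw [← Real.exp_add]
      refine Real.exp_le_exp.2 ?_
      have := hrez₀ k
      have e2 : δ / ‖α‖ + -(δ * κ₁ * t k) = δ * (-(κ₁ * t k) + 1 / ‖α‖) := by ring
      rw [e2]
      exact mul_le_mul_of_nonneg_left (by linarith) hδpos.le
    -- assemble: `‖E z‖ e^{-κ log‖z₀‖} ≤ decay_k < η`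
    have hbase : 0 ≤ A * t k + (1 + 1 / ‖α‖) :=
      add_nonneg (mul_nonneg hA.le (by linarith [ht1 k])) (by positivity)
    have hmain : ‖E z‖ * Real.exp (-(κ * Real.log ‖z₀ k‖)) < η := by
      calc ‖E z‖ * Real.exp (-(κ * Real.log ‖z₀ k‖))
          ≤ (C * (1 + ‖z‖) ^ N'' * Real.exp (δ * z.re)) * (A * t k + (1 + 1 / ‖α‖)) ^ Nκ :=
            mul_le_mul h5 hDinv (Real.exp_nonneg _) (by positivity)
        _ ≤ (C * (A * t k + (1 + 1 / ‖α‖)) ^ N'' *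
              (Real.exp (δ / ‖α‖) * Real.exp (-(δ * κ₁ * t k)))) *
              (A * t k + (1 + 1 / ‖α‖)) ^ Nκ := by
            refine mul_le_mul_of_nonneg_right ?_ (pow_nonneg hbase _)
            refine mul_le_mul ?_ hexp_le (Real.exp_nonneg _)
              (mul_nonneg hC0 (pow_nonneg hbase _))
            exact mul_le_mul_of_nonneg_left (pow_le_pow_left₀ (by positivity) hzle N'') hC0
        _ = C * Real.exp (δ / ‖α‖) *
              ((A * t k + (1 + 1 / ‖α‖)) ^ (N'' + Nκ) * Real.exp (-(δ * κ₁ * t k))) := by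
            rw [pow_add]; ring
        _ < η := hk1
    rw [hD]
    have hpos : 0 < Real.exp (κ * Real.log ‖z₀ k‖) := Real.exp_pos _
    have : ‖E z‖ = ‖E z‖ * Real.exp (-(κ * Real.log ‖z₀ k‖)) * Real.exp (κ * Real.log ‖z₀ k‖) := by
      rw [mul_assoc, ← Real.exp_add, neg_add_cancel, Real.exp_zero, mul_one]
    rw [this]
    exact mul_le_mul_of_nonneg_right hmain.le hpos.le
  -- engine v4
  have hzeros := exists_strip_zeros α b hα0 M q e μ κ hκ' hθ0 hθ hQ z₀ Lg hLz hz₀θ hz₀norm E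
    hEdiff hEs zero_lt_one le_rfl
  obtain ⟨K₁, hK₁⟩ := eventually_atTop.1 hzeros
  have hsol : ∀ k, ∃ u : ℂ, ‖u‖ < min 1 ‖α‖ ∧
      (∑ m ∈ M, (q m).eval (z₀ (k + K₁) + u / α) *
        exp (α * (z₀ (k + K₁) + u / α) + b) ^ (e m)) + E (z₀ (k + K₁) + u / α) = 0 := by
    intro k
    obtain ⟨u, hu, hu0⟩ := hK₁ (k + K₁) (Nat.le_add_left _ _)
    rw [mem_ball, dist_zero_right] at hu
    exact ⟨u, hu, hu0⟩
  choose u hu1 hu0 using hsol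
  have huα : ∀ k, ‖u k / α‖ ≤ 1 := fun k => by
    rw [norm_div, div_le_one hαpos]; exact ((hu1 k).trans_le (min_le_right _ _)).le
  refine ⟨fun k => z₀ (k + K₁) + u k / α, fun k => ?_,
    tendsto_abs_re_div_log_of_linear' (L := fun k => κ₁ * t (k + K₁) - 1) ?_
      (div_pos hA hκ₁) (add_nonneg (div_pos hA hκ₁).le zero_le_one)
      (fun k => ?_) (fun k => ?_)⟩
  · -- the zero of `P(z; e^z, e^{p z})`
    rw [eval₃_exp_eq_mul_edgeSum hE2]
    have h := hu0 k
    rw [← hR (z₀ (k + K₁) + u k / α)] at h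
    simp only [hq_def, he_def] at h
    rw [hEdef] at h
    rw [h, mul_zero]
  · exact tendsto_atTop_add_const_right _ (-1)
      ((htt.comp (tendsto_add_atTop_nat K₁)).const_mul_atTop hκ₁)
  · have h1 := re_le_norm (u k / α)
    rw [Complex.add_re]
    linarith [hrez₀ (k + K₁), huα k]
  · have h1 : ‖z₀ (k + K₁) + u k / α‖ ≤ A * t (k + K₁) + 1 :=
      (norm_add_le _ _).trans (add_le_add (hnz₀ _) (huα k))
    have e1 : A / κ₁ * (κ₁ * t (k + K₁) - 1) + (A / κ₁ + 1) = A * t (k + K₁) + 1 := by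
      field_simp
      ring
    rw [e1]; exact h1

end Summit.Schanuel.Schanuel.Theorems
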